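import Mathlib
import HarnessLib
import Summits.Ventures.LatticeQCDFlow.Exactness.LazyRelaxationLagLaw

/-!
# Granularity versus relaxation at a fixed sweep budget (lazy layers): halving the switch never hurts when the equilibrium drops are equal

HONEST FRAMING: exact (Metropolis-corrected) sampling algorithms for lattice gauge theory;
figures of merit are autocorrelation/cost numbers at stated couplings and volumes; no
continuum-physics claim.

Venture `LatticeQCDFlow` (cell pub-lqcd), topic `Exactness`, FANOUT row 8 (s0-cpn-nemc, GEN-5).
OUR WORK (elementary), nothing cited as a fact.  Row 8 GEN-3 typed the QUASI-STATIC half of the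
design lever "buy granularity, not relaxation" (`qsDissipation_uniform_two_mul_le`: halving the
switch never raises the floor).  With the lag law (`Exactness/LazyRelaxationLagLaw.lean`) the
DYNAMIC half can be asked at a FIXED relaxation budget: `2n` switches with ONE lazy sweep of
laziness `ε` each, versus `n` switches with TWO sweeps each — which is one lazy layer of laziness
`ε²` (`sum_lazyLayer_mul_lazyLayer`: `(εI + (1−ε)Π)(ε'I + (1−ε')Π) = εε'I + (1−εε')Π`).

* `sum_lazyLayer_mul_lazyLayer` — composing lazy sweeps multiplies the laziness;
* `lagSeq_const_bound`, `lagSeq_pair_invariant` (`2ε·e_{2b} = (1+ε)·E_b` for the fine lag `e`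
  with constant drop `δ` and the coarse lag `E` with drop `2δ` and laziness `ε²`),
  `lagSeq_pair_block_le` (**per block `e_{2b} + e_{2b+1} ≤ δ + 2E_b`**);
* **`lazyDissipation_halving_le`** — if the equilibrium drops of the switch observable along the
  fine grid are all equal (`⟨D⟩_{j/2n} − ⟨D⟩_{(j+1)/2n} = δ`, i.e. `Var_c(D)` constant to this
  order), then for every `0 ≤ ε ≤ 1`
  `⟨W⟩ − ΔF [2n steps, laziness ε] ≤ ⟨W⟩ − ΔF [n steps, laziness ε²]`:
  at equal sweep budget the finer protocol dissipates no more.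

NOT a theorem without the equal-drop hypothesis (HOME/s0-cpn-nemc/RESULTS.md §12(d), numerical):
a 2-state system whose `⟨D⟩_c` drops in one step inside `(1/4, 1/2)` has, at `(n, ε) = (2, 1/2)`,
fine MINUS coarse `= +25` in units where the drop is `400` — relaxation is worth most right after
the largest drops, and the fine protocol wastes a sweep before the drop.  For smooth `⟨D⟩_c`
(BNV's defect protocol: `Var_c(D)` varies ×7.4 over `c` without a step, RESULTS §9) no violation was
found in 72 168 sampled systems; only the equal-drop case is typed here.
-/

namespace Summit.Ventures.LatticeQCDFlow.Exactness

open Finset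
open Literature.Probability.MarkovChains (stepLaw)
open Summit.Ventures.LatticeQCDFlow.Theory2

variable {X : Type*} [Fintype X]

/-! ## Two sweeps are one lazier layer -/

/-- Composing lazy sweeps multiplies the laziness:
`Σ_y P_ε(x, y) P_{ε'}(y, z) = P_{εε'}(x, z)` for a normalised `π`. -/
theorem sum_lazyLayer_mul_lazyLayer [DecidableEq X] {π : X → ℝ} (hπ : ∑ y, π y = 1) (ε ε' : ℝ)
    (x z : X) : ∑ y, lazyLayer π ε x y * lazyLayer π ε' y z = lazyLayer π (ε * ε') x z := by
  have h := stepLaw_lazyLayer π ε' (μ := lazyLayer π ε x) (sum_lazyLayer hπ ε x) z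
  unfold stepLaw at h
  rw [h]
  unfold lazyLayer
  ring

/-! ## The lag with equal drops: fine versus coarse -/

/-- With a constant drop the lag saturates: `(1 − ε) e_j ≤ ε δ`. -/
theorem lagSeq_const_bound {ε δ : ℝ} (h0 : 0 ≤ ε) (h1 : ε ≤ 1) (hδ : 0 ≤ δ) :
    ∀ j, (1 - ε) * lagSeq ε (fun _ => δ) j ≤ ε * δ
  | 0 => by simpa using mul_nonneg h0 hδ
  | j + 1 => by
      rw [lagSeq_succ]
      have ih := lagSeq_const_bound h0 h1 hδ j
      have ih' := mul_le_mul_of_nonneg_left ih h0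
      have he := lagSeq_nonneg h0 (fun _ => hδ) j
      nlinarith [mul_nonneg h0 hδ, mul_nonneg h0 he]

/-- **Block invariant.**  Fine lag `e` (drop `δ`, laziness `ε`) at even times versus coarse lag `E`
(drop `2δ`, laziness `ε²`): `2ε · e_{2b} = (1 + ε) · E_b`. -/
theorem lagSeq_pair_invariant (ε δ : ℝ) :
    ∀ b, 2 * ε * lagSeq ε (fun _ => δ) (2 * b) = (1 + ε) * lagSeq (ε ^ 2) (fun _ => 2 * δ) b
  | 0 => by simp
  | b + 1 => by
      have ih := lagSeq_pair_invariant ε δ b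
      rw [show 2 * (b + 1) = 2 * b + 1 + 1 by ring, lagSeq_succ, lagSeq_succ, lagSeq_succ]
      linear_combination (ε ^ 2) * ih

/-- **Per-block comparison.**  `e_{2b} + e_{2b+1} ≤ δ + 2 E_b` for `0 ≤ ε ≤ 1`, `δ ≥ 0`: the two
fine steps of a block lag in total by at most the drop `δ` the coarse step pays for holding a stale
configuration, plus twice the coarse lag. -/
theorem lagSeq_pair_block_le {ε δ : ℝ} (h0 : 0 ≤ ε) (h1 : ε ≤ 1) (hδ : 0 ≤ δ) (b : ℕ) :
    lagSeq ε (fun _ => δ) (2 * b) + lagSeq ε (fun _ => δ) (2 * b + 1)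
      ≤ δ + 2 * lagSeq (ε ^ 2) (fun _ => 2 * δ) b := by
  rw [lagSeq_succ]
  have hinv := lagSeq_pair_invariant ε δ b
  have hb := lagSeq_const_bound h0 h1 hδ (2 * b)
  have hb' := mul_le_mul_of_nonneg_left hb (sub_nonneg.mpr h1)
  have key : (1 + ε) * (lagSeq ε (fun _ => δ) (2 * b) + ε * (lagSeq ε (fun _ => δ) (2 * b) + δ))
      ≤ (1 + ε) * (δ + 2 * lagSeq (ε ^ 2) (fun _ => 2 * δ) b) := by
    nlinarith [mul_nonneg (sub_nonneg.mpr h1) hδ, hinv, hb']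
  exact le_of_mul_le_mul_left key (by linarith)

/-- The lag depends only on the drops seen so far. -/
theorem lagSeq_congr (ε : ℝ) {δ δ' : ℕ → ℝ} :
    ∀ {j : ℕ}, (∀ i < j, δ i = δ' i) → lagSeq ε δ j = lagSeq ε δ' j
  | 0, _ => rfl
  | j + 1, h => by
      rw [lagSeq_succ, lagSeq_succ, lagSeq_congr ε (fun i hi => h i (Nat.lt_succ_of_lt hi)),
        h j (Nat.lt_succ_self j)]

/-! ## Halving the switch at fixed sweep budget -/

/-- **Granularity at a fixed sweep budget (equal drops).**  For the linear protocol with lazy layers,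
if the equilibrium drops of `⟨D⟩` along the fine grid `j/(2n)` are all equal to `δ`, then the
`2n`-step protocol with ONE sweep of laziness `ε` per step dissipates no more than the `n`-step
protocol with TWO such sweeps per step (one layer of laziness `ε²`), for every `0 ≤ ε ≤ 1`. -/
theorem lazyDissipation_halving_le [Nonempty X] [DecidableEq X] (S₀ D : X → ℝ) {n : ℕ}
    (hn : n ≠ 0) {ε : ℝ} (h0 : 0 ≤ ε) (h1 : ε ≤ 1) {δ : ℝ}
    (hδ : ∀ j < 2 * n, meanD S₀ D ((j : ℝ) / (2 * n)) - meanD S₀ D (((j + 1 : ℕ) : ℝ) / (2 * n)) = δ) :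
    lazyDissipation S₀ D (fun k => (k : ℝ) / (2 * n)) ε (2 * n)
      ≤ lazyDissipation S₀ D (fun k => (k : ℝ) / n) (ε ^ 2) n := by
  have hn' : (n : ℝ) ≠ 0 := Nat.cast_ne_zero.mpr hn
  have hnpos : (0 : ℝ) < n := Nat.cast_pos.mpr (Nat.pos_of_ne_zero hn)
  -- the drop is non-negative
  have hδ0 : 0 ≤ δ := by
    rw [← hδ 0 (by omega)]
    refine sub_nonneg.mpr (meanD_antitone S₀ D ?_)
    exact div_le_div_of_nonneg_right (by exact_mod_cast Nat.zero_le 1) (by positivity)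
  -- cast bookkeeping
  have e1 : ∀ k : ℕ, ((2 * k : ℕ) : ℝ) / (2 * n) = (k : ℝ) / n := fun k => by
    push_cast
    exact mul_div_mul_left _ _ two_ne_zero
  have e2 : ∀ k : ℕ, ((2 * k + 1 + 1 : ℕ) : ℝ) / (2 * n) = ((k + 1 : ℕ) : ℝ) / n := fun k => by
    push_cast
    rw [show (2 * (k : ℝ) + 1 + 1) = 2 * ((k : ℝ) + 1) by ring]
    exact mul_div_mul_left _ _ two_ne_zero
  have stepF : ∀ j : ℕ, ((j + 1 : ℕ) : ℝ) / (2 * n) - (j : ℝ) / (2 * n) = 1 / (2 * n) := fun j => by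
    rw [Nat.cast_succ]
    ring
  have stepC : ∀ b : ℕ, ((b + 1 : ℕ) : ℝ) / n - (b : ℝ) / n = 1 / n := fun b => by
    rw [Nat.cast_succ]
    field_simp
    ring
  -- the fine and the coarse lags are the constant-drop lags
  have lagF : ∀ j ≤ 2 * n, lagSeq ε (fun i => meanD S₀ D ((i : ℝ) / (2 * n))
        - meanD S₀ D (((i + 1 : ℕ) : ℝ) / (2 * n))) j = lagSeq ε (fun _ => δ) j :=
    fun j hj => lagSeq_congr ε (fun i hi => hδ i (by omega))
  have lagC : ∀ b ≤ n, lagSeq (ε ^ 2) (fun i => meanD S₀ D ((i : ℝ) / n)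
        - meanD S₀ D (((i + 1 : ℕ) : ℝ) / n)) b = lagSeq (ε ^ 2) (fun _ => 2 * δ) b := by
    intro b hb
    refine lagSeq_congr (ε ^ 2) (fun i hi => ?_)
    have h1' := hδ (2 * i) (by omega)
    have h2' := hδ (2 * i + 1) (by omega)
    rw [e1] at h1'
    rw [e2] at h2'
    show meanD S₀ D ((i : ℝ) / n) - meanD S₀ D (((i + 1 : ℕ) : ℝ) / n) = 2 * δ
    linarith [h1', h2']
  -- both dissipations as step sums
  have hF := meanWork_lazy_eq S₀ D (fun k => (k : ℝ) / (2 * n)) ε (2 * n)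
  have hC := meanWork_lazy_eq S₀ D (fun k => (k : ℝ) / n) (ε ^ 2) n
  beta_reduce at hF hC
  unfold lazyDissipation
  beta_reduce
  rw [hF, hC]
  -- endpoints of both grids coincide
  have a1 : ((2 * n : ℕ) : ℝ) / (2 * n) = (n : ℝ) / n := by
    rw [div_self hn']
    push_cast
    field_simp
  have a2 : ((0 : ℕ) : ℝ) / (2 * (n : ℝ)) = ((0 : ℕ) : ℝ) / (n : ℝ) := by simp
  rw [a1, a2]
  -- compare the step sums block by block
  have hw0 : (0 : ℝ) ≤ 1 / (2 * n) := by positivity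
  have hw : (1 : ℝ) / n = 2 * (1 / (2 * n)) := by field_simp
  have hsum : ∑ j ∈ range (2 * n), (((j + 1 : ℕ) : ℝ) / (2 * n) - (j : ℝ) / (2 * n))
        * (meanD S₀ D ((j : ℝ) / (2 * n)) + lagSeq ε (fun i => meanD S₀ D ((i : ℝ) / (2 * n))
            - meanD S₀ D (((i + 1 : ℕ) : ℝ) / (2 * n))) j)
      ≤ ∑ b ∈ range n, (((b + 1 : ℕ) : ℝ) / n - (b : ℝ) / n)
        * (meanD S₀ D ((b : ℝ) / n) + lagSeq (ε ^ 2) (fun i => meanD S₀ D ((i : ℝ) / n)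
            - meanD S₀ D (((i + 1 : ℕ) : ℝ) / n)) b) := by
    simp_rw [stepF, stepC]
    rw [sum_congr rfl (fun j hj => by rw [lagF j (mem_range.mp hj).le]),
      sum_range_two_mul_pair]
    refine sum_le_sum (fun b hb => ?_)
    have hbn : b < n := mem_range.mp hb
    rw [lagC b hbn.le, e1 b, hw]
    have hM := hδ (2 * b) (by omega)
    rw [e1 b] at hM
    have hM' : meanD S₀ D (((2 * b + 1 : ℕ) : ℝ) / (2 * n)) = meanD S₀ D ((b : ℝ) / n) - δ := by
      linarith
    rw [hM']
    have hbl := mul_le_mul_of_nonneg_left (lagSeq_pair_block_le h0 h1 hδ0 b) hw0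
    linarith
  linarith

end Summit.Ventures.LatticeQCDFlow.Exactness
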